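import Summits.ResolutionOfSingularities.ResolutionOfSingularities.Theorems.WeightedInvariantIota3LemmaCPlanes
import HarnessLib

/-!
# LEMMA C of the residue hres₃, SECOND CASE reduced to a FUNCTIONAL EQUATION: same tangent plane (`β̄ ≠ 0`) ⇒
# `Φ(X₁, X₂) = Φ(X₁ + ε X₀^j, X₂ + τ)` with `ε ≠ 0`, `τ ∈ κ[X₀, X₁]`
# (door `HypersurfaceCentreConstruction`, stmt-ResolutionOfSingularities-19897; gap list `keyRungGrHomLE_three_of_lemmaC`)

Helper for `stub_keyRungGrHomLE_three` (def-free, `--supports 19897`).  Sequel of …Iota3LemmaCPlanes (shapes `η = ēX₀^j + β̄X₁`,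
`ζ = λ̄X₂ + ϑ`; LEMMA C for `β̄ = 0`).  Here the case `β̄ ≠ 0`: the substitution `σ₀ : X₁ ↦ β̄X₁, X₂ ↦ λ̄X₂ + tX₁^ρ` (the `X₀ ↦ 0`
specialisation of `X₁ ↦ η, X₂ ↦ ζ`) also carries `Θ = Σ θ_e X₁^{e₁}X₂^{e₂}` to `Φ`, and is INVERTIBLE; composing, `Φ` is fixed by the
triangular substitution `X₁ ↦ X₁ + εX₀^j` (`ε = ē/β̄ ≠ 0`), `X₂ ↦ X₂ + τ` with `τ` free of `X₂` (`exists_functional_equation`).  Hence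
**LEMMA C ⟸ LEMMA C′** (`lemmaC_of_functional`): «a pure `Φ ∈ κ[X₁,X₂]` (monomials `X₁^{e₁}X₂^{e₂}`, `r₁e₂ + r₂e₁ = r₁ν`) containing `X₂^ν` and
fixed by `X₁ ↦ X₁ + εX₀^j`, `X₂ ↦ X₂ + τ` (`ε ≠ 0`, `τ ∈ κ[X₀,X₁]`) is `u(X₂ − aX₁^{r₁/r₂})^ν`, `a ≠ 0` only if `r₂ ∣ r₁`» — the statement the
Hasse-derivative argument of RESIDUE-PLAN.md §3 proves (char `0`/`p ∤ ν`: Tschirnhaus; `ν = p^eν₁`: `D^{(p^e)}` + induction; `ν = p^e`: Frobenius).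
[OURS · L1 W4.3 · (o70-b)/(Δ12); AI work, weaker than expert review; nothing here is a statement of the manuscript under review.]
-/

noncomputable section

open MvPolynomial

set_option linter.dupNamespace false -- mandated namespace of this single-conjunct summit

namespace Summit.ResolutionOfSingularities.ResolutionOfSingularities.Cruxes.HypersurfaceCentreConstruction.LocalEngine

namespace Iota3

namespace LemmaC

variable {κ : Type} [Field κ]

/-- Substitutions agree on a polynomial free of `X₀` once they agree on `X₁`, `X₂`. [folklore] -/
theorem aeval_congr_of_no_X₀ {P : MvPolynomial (Fin 3) κ} (hP : ∀ e ∈ P.support, e 0 = 0)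
    {f g : Fin 3 → MvPolynomial (Fin 3) κ} (h1 : f 1 = g 1) (h2 : f 2 = g 2) : aeval f P = aeval g P := by
  classical
  have key : ∀ e ∈ P.support, aeval f (monomial e (P.coeff e)) = aeval g (monomial e (P.coeff e)) := by
    intro e he
    rw [aeval_monomial, aeval_monomial, Finsupp.prod_fintype _ _ (by simp), Finsupp.prod_fintype _ _ (by simp),
      Fin.prod_univ_three, Fin.prod_univ_three, hP e he, pow_zero, pow_zero, h1, h2]
  calc aeval f P = aeval f (∑ e ∈ P.support, monomial e (P.coeff e)) := by rw [← P.as_sum]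
    _ = ∑ e ∈ P.support, aeval f (monomial e (P.coeff e)) := map_sum _ _ _
    _ = ∑ e ∈ P.support, aeval g (monomial e (P.coeff e)) := Finset.sum_congr rfl key
    _ = aeval g (∑ e ∈ P.support, monomial e (P.coeff e)) := (map_sum _ _ _).symm
    _ = aeval g P := by rw [← P.as_sum]

/-- `degreeOf 2` of a finite sum is `0` if it is for every term. [folklore] -/
theorem degreeOf_sum_eq_zero {ι : Type} (s : Finset ι) (f : ι → MvPolynomial (Fin 3) κ) (i : Fin 3)
    (h : ∀ a ∈ s, (f a).degreeOf i = 0) : (∑ a ∈ s, f a).degreeOf i = 0 := by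
  classical
  induction s using Finset.induction_on with
  | empty => rw [Finset.sum_empty, ← C_0, degreeOf_C]
  | insert a s ha ih =>
    rw [Finset.sum_insert ha]
    have h1 := degreeOf_add_le i (f a) (∑ x ∈ s, f x)
    rw [h a (Finset.mem_insert_self a s), ih fun b hb => h b (Finset.mem_insert_of_mem hb)] at h1
    omega

/-- Killing `X₀` in `ϑ = ζ − λ̄X₂`: the result is `t X₁^{r₁/r₂}` (`t = 0` unless `r₂ ∣ r₁`). [folklore] -/
theorem aeval_killX₀_theta {r₁ r₂ j : ℕ} (hr₂ : 0 < r₂) (hr : r₂ < r₁) (hj : 1 ≤ j) {ζ : MvPolynomial (Fin 3) κ}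
    (hζ : ζ.IsWeightedHomogeneous (![r₂, j * r₂, j * r₁] : Fin 3 → ℕ) (j * r₁)) :
    aeval (fun i : Fin 3 => if i = 0 then (0 : MvPolynomial (Fin 3) κ) else X i) (ζ - C (ζ.coeff (Finsupp.single 2 1)) * X 2) =
      C (if r₂ ∣ r₁ then (ζ - C (ζ.coeff (Finsupp.single 2 1)) * X 2).coeff (Finsupp.single 1 (r₁ / r₂)) else 0) *
        X 1 ^ (r₁ / r₂) := by
  classical
  set θζ := ζ - C (ζ.coeff (Finsupp.single 2 1)) * X 2 with hθζ
  have hθζsupp := zeta_shape hr₂ hr hj hζ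
  set t : κ := if r₂ ∣ r₁ then θζ.coeff (Finsupp.single 1 (r₁ / r₂)) else 0 with ht
  conv_lhs => rw [θζ.as_sum]
  rw [map_sum]
  have key : ∀ e ∈ θζ.support, aeval (fun i : Fin 3 => if i = 0 then (0 : MvPolynomial (Fin 3) κ) else X i)
      (monomial e (θζ.coeff e)) =
      if e = Finsupp.single 1 (r₁ / r₂) ∧ r₂ ∣ r₁ then C (θζ.coeff e) * X 1 ^ (r₁ / r₂) else 0 := by
    intro e he
    obtain ⟨he2, hwe⟩ := hθζsupp e he
    rw [aeval_monomial, Finsupp.prod_fintype _ _ (by simp), Fin.prod_univ_three, algebraMap_eq]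
    simp only [Fin.isValue, if_true, show (1 : Fin 3) ≠ 0 by decide, show (2 : Fin 3) ≠ 0 by decide, if_false, he2, pow_zero,
      mul_one]
    rcases Nat.eq_zero_or_pos (e 0) with h0 | h0
    · rw [h0, pow_zero, one_mul]
      rw [h0, mul_zero, zero_add] at hwe
      have hdiv : r₂ ∣ r₁ := by
        refine ⟨e 1, ?_⟩
        have : j * (r₂ * e 1) = j * r₁ := by rw [← hwe]; ring
        exact (Nat.eq_of_mul_eq_mul_left hj this).symm
      have he1 : e 1 = r₁ / r₂ := by
        obtain ⟨k, hk⟩ := hdiv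
        rw [hk, Nat.mul_div_cancel_left _ hr₂]
        have : j * r₂ * e 1 = j * r₂ * k := by rw [hwe, hk]; ring
        exact Nat.eq_of_mul_eq_mul_left (Nat.mul_pos hj hr₂) this
      have hee : e = Finsupp.single 1 (r₁ / r₂) := by
        ext i; fin_cases i <;> simp [h0, he1, he2]
      rw [if_pos ⟨hee, hdiv⟩, ← he1]
    · rw [zero_pow (by omega), zero_mul, mul_zero]
      rw [if_neg]
      rintro ⟨hee, -⟩
      rw [hee] at h0
      simp at h0
  rw [Finset.sum_congr rfl key]
  by_cases hdiv : r₂ ∣ r₁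
  · by_cases hmem : Finsupp.single 1 (r₁ / r₂) ∈ θζ.support
    · rw [Finset.sum_ite, Finset.sum_const_zero, add_zero]
      have hfilter : θζ.support.filter (fun e => e = Finsupp.single 1 (r₁ / r₂) ∧ r₂ ∣ r₁) = {Finsupp.single 1 (r₁ / r₂)} := by
        ext e
        simp only [Finset.mem_filter, Finset.mem_singleton]
        constructor
        · rintro ⟨-, h, -⟩; exact h
        · intro h; exact ⟨h ▸ hmem, h, hdiv⟩
      rw [hfilter, Finset.sum_singleton, ht, if_pos hdiv]
    · rw [Finset.sum_eq_zero]
      · rw [ht, if_pos hdiv, notMem_support_iff.mp hmem, map_zero, zero_mul]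
      · intro e he
        rw [if_neg]
        rintro ⟨h, -⟩
        exact hmem (h ▸ he)
  · rw [Finset.sum_eq_zero]
    · rw [ht, if_neg hdiv, map_zero, zero_mul]
    · intro e _
      rw [if_neg]
      rintro ⟨-, h⟩
      exact hdiv h

/-- **THE FUNCTIONAL EQUATION** (LEMMA C, case `β̄ ≠ 0`): with the hypotheses of LEMMA C and `η.coeff X₁ ≠ 0` there are `ε ≠ 0` and
`τ ∈ κ[X₀, X₁]` with `Φ = Φ(X₀, X₁ + εX₀^j, X₂ + τ)`. [OURS · L1 W4.3 · (o70-b)/(Δ12)] -/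
theorem exists_functional_equation {r₁ r₂ j ν : ℕ} (hr₂ : 0 < r₂) (hr : r₂ < r₁) (hj : 1 ≤ j) (hν : 1 ≤ ν)
    {Φ η ζ : MvPolynomial (Fin 3) κ} {s : Finset (Fin 3 →₀ ℕ)} {θ : (Fin 3 →₀ ℕ) → κ}
    (hΦ : ∀ e ∈ Φ.support, e 0 = 0 ∧ r₁ * e 2 + r₂ * e 1 = r₁ * ν) (hΦν : Φ.coeff (Finsupp.single 2 ν) ≠ 0)
    (hηhom : η.IsWeightedHomogeneous (![r₂, j * r₂, j * r₁] : Fin 3 → ℕ) (j * r₂))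
    (hζhom : ζ.IsWeightedHomogeneous (![r₂, j * r₂, j * r₁] : Fin 3 → ℕ) (j * r₁))
    (hs : ∀ e ∈ s, e 0 = 0 ∧ r₁ * e 2 + r₂ * e 1 = r₁ * ν) (hΦeq : Φ = ∑ e ∈ s, C (θ e) * (η ^ (e 1) * ζ ^ (e 2)))
    (hē : η.coeff (Finsupp.single 0 j) ≠ 0) (hβ : η.coeff (Finsupp.single 1 1) ≠ 0) :
    ∃ (ε : κ) (τ : MvPolynomial (Fin 3) κ), ε ≠ 0 ∧ (∀ e ∈ τ.support, e 2 = 0) ∧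
      Φ = aeval ![X 0, X 1 + C ε * X 0 ^ j, X 2 + τ] Φ := by
  classical
  -- names
  set eb := η.coeff (Finsupp.single 0 j) with heb
  set bb := η.coeff (Finsupp.single 1 1) with hbb
  set lam := ζ.coeff (Finsupp.single 2 1) with hlam
  set ϑ := ζ - C lam * X 2 with hϑ
  set t : κ := if r₂ ∣ r₁ then ϑ.coeff (Finsupp.single 1 (r₁ / r₂)) else 0 with ht
  have hηs : η = C eb * X 0 ^ j + C bb * X 1 := eta_shape hr₂ hr hj hηhom
  have hζs : ζ = C lam * X 2 + ϑ := by rw [hϑ]; ring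
  have hϑsupp := zeta_shape hr₂ hr hj hζhom
  -- degrees in `X₂`
  have hdegη : η.degreeOf 2 = 0 := by
    have h := degreeOf_le_iff.mpr (fun m hm => ?_ : ∀ m ∈ η.support, m (2 : Fin 3) ≤ 0)
    · omega
    · have hwd := hηhom (mem_support_iff.mp hm)
      rw [weight_eq] at hwd
      rcases exponent_of_weight_critical₂ hr₂ hr hj hwd with h | h <;> simp [h]
  have hdegϑ : ϑ.degreeOf 2 = 0 := by
    have h := degreeOf_le_iff.mpr (fun m hm => ?_ : ∀ m ∈ ϑ.support, m (2 : Fin 3) ≤ 0)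
    · omega
    · exact (hϑsupp m hm).1.le
  -- `Θ` and `aeval (X₀, η, ζ) Θ = Φ`
  set Θ : MvPolynomial (Fin 3) κ := ∑ e ∈ s, monomial e (θ e) with hΘ
  have hΘsupp : ∀ e ∈ Θ.support, e 0 = 0 := by
    intro e he
    obtain ⟨d, hd, hed⟩ := Finset.mem_biUnion.mp (MvPolynomial.support_sum he)
    rw [support_monomial] at hed
    split_ifs at hed with h0
    · simp at hed
    · rw [Finset.mem_singleton] at hed; rw [hed]; exact (hs d hd).1
  have haevalΘ : ∀ (g : Fin 3 → MvPolynomial (Fin 3) κ),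
      aeval g Θ = ∑ e ∈ s, C (θ e) * (g 0 ^ (e 0) * g 1 ^ (e 1) * g 2 ^ (e 2)) := by
    intro g
    rw [hΘ, map_sum]
    refine Finset.sum_congr rfl fun e he => ?_
    rw [aeval_monomial, Finsupp.prod_fintype _ _ (by simp), Fin.prod_univ_three, algebraMap_eq]
  have hσΘ : aeval ![X 0, η, ζ] Θ = Φ := by
    rw [haevalΘ, hΦeq]
    refine Finset.sum_congr rfl fun e he => ?_
    simp only [Matrix.cons_val_zero, Matrix.cons_val_one, Matrix.cons_val_two, Matrix.head_cons, Matrix.tail_cons,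
      (hs e he).1, pow_zero, one_mul]
  -- `λ̄ ≠ 0`: otherwise `Φ` would be free of `X₂`
  have hlam0 : lam ≠ 0 := by
    intro h0
    have hζϑ : ζ = ϑ := by rw [hζs, h0, map_zero, zero_mul, zero_add]
    have hdegΦ : Φ.degreeOf 2 = 0 := by
      rw [← hσΘ, haevalΘ]
      refine degreeOf_sum_eq_zero _ _ _ fun e he => ?_
      simp only [Matrix.cons_val_zero, Matrix.cons_val_one, Matrix.cons_val_two, Matrix.head_cons, Matrix.tail_cons]
      have h1 := degreeOf_mul_le (2 : Fin 3) (C (θ e)) (X 0 ^ e 0 * η ^ e 1 * ζ ^ e 2)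
      have h2 := degreeOf_mul_le (2 : Fin 3) (X 0 ^ e 0 * η ^ e 1) (ζ ^ e 2)
      have h3 := degreeOf_mul_le (2 : Fin 3) (X 0 ^ e 0) (η ^ e 1)
      have h4 := degreeOf_pow_le (2 : Fin 3) η (e 1)
      have h5 := degreeOf_pow_le (2 : Fin 3) ζ (e 2)
      have hdegζ : ζ.degreeOf 2 = 0 := by rw [hζϑ]; exact hdegϑ
      rw [degreeOf_C] at h1
      rw [degreeOf_X_pow_of_ne _ (by decide : (2 : Fin 3) ≠ 0)] at h3
      rw [hdegη, mul_zero] at h4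
      rw [hdegζ, mul_zero] at h5
      omega
    have := degreeOf_le_iff.mp hdegΦ.le (Finsupp.single 2 ν) (mem_support_iff.mpr hΦν)
    simp at this
    omega
  -- `σ₀ Θ = Φ` with `σ₀ = (X₀, β̄X₁, λ̄X₂ + tX₁^ρ)`
  set π₀ : MvPolynomial (Fin 3) κ →ₐ[κ] MvPolynomial (Fin 3) κ :=
    aeval (fun i : Fin 3 => if i = 0 then (0 : MvPolynomial (Fin 3) κ) else X i) with hπ₀
  have hπX0 : π₀ (X 0) = 0 := by rw [hπ₀, aeval_X]; simp
  have hπX1 : π₀ (X 1) = X 1 := by rw [hπ₀, aeval_X]; simp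
  have hπX2 : π₀ (X 2) = X 2 := by rw [hπ₀, aeval_X]; simp
  have hπC : ∀ c : κ, π₀ (C c) = C c := fun c => by rw [hπ₀, aeval_C, algebraMap_eq]
  have hπη : π₀ η = C bb * X 1 := by
    rw [hηs, map_add, map_mul, map_mul, map_pow, hπC, hπC, hπX0, hπX1, zero_pow (by omega), mul_zero, zero_add]
  have hπζ : π₀ ζ = C lam * X 2 + C t * X 1 ^ (r₁ / r₂) := by
    rw [hζs, map_add, map_mul, hπC, hπX2, hϑ, hlam, hπ₀, aeval_killX₀_theta hr₂ hr hj hζhom]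
  have hσ₀Θ : aeval ![X 0, C bb * X 1, C lam * X 2 + C t * X 1 ^ (r₁ / r₂)] Θ = Φ := by
    have h1 : π₀ (aeval ![X 0, η, ζ] Θ) = Φ := by rw [hσΘ, hπ₀]; exact aeval_killX₀_eq_self fun e he => (hΦ e he).1
    rw [← AlgHom.comp_apply, comp_aeval] at h1
    rw [← h1]
    refine aeval_congr_of_no_X₀ hΘsupp ?_ ?_
    · show C bb * X 1 = π₀ η
      exact hπη.symm
    · show C lam * X 2 + C t * X 1 ^ (r₁ / r₂) = π₀ ζ
      exact hπζ.symm
  -- the inverse substitution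
  set ginv : Fin 3 → MvPolynomial (Fin 3) κ :=
    ![X 0, C bb⁻¹ * X 1, C lam⁻¹ * (X 2 - C (t * bb⁻¹ ^ (r₁ / r₂)) * X 1 ^ (r₁ / r₂))] with hginv
  have hinv : (fun i => aeval ginv (![X 0, C bb * X 1, C lam * X 2 + C t * X 1 ^ (r₁ / r₂)] i)) = X := by
    funext i
    fin_cases i
    · show aeval ginv (X 0) = X 0
      rw [aeval_X]; rfl
    · show aeval ginv (C bb * X 1) = X 1
      rw [map_mul, aeval_C, aeval_X, algebraMap_eq]
      show C bb * (C bb⁻¹ * X 1) = (X 1 : MvPolynomial (Fin 3) κ)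
      rw [← mul_assoc, ← map_mul, mul_inv_cancel₀ hβ, map_one, one_mul]
    · show aeval ginv (C lam * X 2 + C t * X 1 ^ (r₁ / r₂)) = X 2
      rw [map_add, map_mul, map_mul, map_pow, aeval_C, aeval_C, aeval_X, aeval_X, algebraMap_eq]
      show C lam * (C lam⁻¹ * (X 2 - C (t * bb⁻¹ ^ (r₁ / r₂)) * X 1 ^ (r₁ / r₂))) + C t * (C bb⁻¹ * X 1) ^ (r₁ / r₂) =
        (X 2 : MvPolynomial (Fin 3) κ)
      have h1 : (C lam * C lam⁻¹ : MvPolynomial (Fin 3) κ) = 1 := by rw [← map_mul, mul_inv_cancel₀ hlam0, map_one]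
      have h2 : (C t * C (bb⁻¹ ^ (r₁ / r₂)) : MvPolynomial (Fin 3) κ) = C (t * bb⁻¹ ^ (r₁ / r₂)) := by rw [← map_mul]
      calc (C lam * (C lam⁻¹ * (X 2 - C (t * bb⁻¹ ^ (r₁ / r₂)) * X 1 ^ (r₁ / r₂))) + C t * (C bb⁻¹ * X 1) ^ (r₁ / r₂) :
            MvPolynomial (Fin 3) κ)
          = (C lam * C lam⁻¹) * (X 2 - C (t * bb⁻¹ ^ (r₁ / r₂)) * X 1 ^ (r₁ / r₂)) +
              (C t * C (bb⁻¹ ^ (r₁ / r₂))) * X 1 ^ (r₁ / r₂) := by rw [mul_pow, ← map_pow]; ring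
        _ = X 2 := by rw [h1, h2]; ring
  have hΘeq : Θ = aeval ginv Φ := by
    rw [← hσ₀Θ, ← AlgHom.comp_apply, comp_aeval, hinv, aeval_X_left_apply]
  -- the functional equation
  set ε : κ := eb * bb⁻¹ with hε
  set τ : MvPolynomial (Fin 3) κ := C lam⁻¹ * ϑ + C (-(lam⁻¹ * (t * bb⁻¹ ^ (r₁ / r₂)))) * η ^ (r₁ / r₂) with hτ
  have hcomp : (fun i => aeval ![X 0, η, ζ] (ginv i)) = ![X 0, X 1 + C ε * X 0 ^ j, X 2 + τ] := by
    funext i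
    fin_cases i
    · show aeval ![X 0, η, ζ] (X 0) = X 0
      rw [aeval_X]; rfl
    · show aeval ![X 0, η, ζ] (C bb⁻¹ * X 1) = X 1 + C ε * X 0 ^ j
      rw [map_mul, aeval_C, aeval_X, algebraMap_eq]
      show C bb⁻¹ * η = X 1 + C ε * X 0 ^ j
      rw [hηs]
      have h1 : (C bb⁻¹ * C bb : MvPolynomial (Fin 3) κ) = 1 := by rw [← map_mul, inv_mul_cancel₀ hβ, map_one]
      have h2 : (C eb * C bb⁻¹ : MvPolynomial (Fin 3) κ) = C ε := by rw [← map_mul]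
      calc (C bb⁻¹ * (C eb * X 0 ^ j + C bb * X 1) : MvPolynomial (Fin 3) κ)
          = (C bb⁻¹ * C bb) * X 1 + (C eb * C bb⁻¹) * X 0 ^ j := by ring
        _ = X 1 + C ε * X 0 ^ j := by rw [h1, h2]; ring
    · show aeval ![X 0, η, ζ] (C lam⁻¹ * (X 2 - C (t * bb⁻¹ ^ (r₁ / r₂)) * X 1 ^ (r₁ / r₂))) = X 2 + τ
      rw [map_mul, map_sub, map_mul, map_pow, aeval_C, aeval_C, aeval_X, aeval_X, algebraMap_eq]
      show C lam⁻¹ * (ζ - C (t * bb⁻¹ ^ (r₁ / r₂)) * η ^ (r₁ / r₂)) = X 2 + τ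
      rw [hζs, hτ]
      have h1 : (C lam⁻¹ * C lam : MvPolynomial (Fin 3) κ) = 1 := by rw [← map_mul, inv_mul_cancel₀ hlam0, map_one]
      have h2 : (-(C lam⁻¹ * C (t * bb⁻¹ ^ (r₁ / r₂))) : MvPolynomial (Fin 3) κ) = C (-(lam⁻¹ * (t * bb⁻¹ ^ (r₁ / r₂)))) := by
        rw [← map_mul, ← map_neg]
      calc (C lam⁻¹ * (C lam * X 2 + ϑ - C (t * bb⁻¹ ^ (r₁ / r₂)) * η ^ (r₁ / r₂)) : MvPolynomial (Fin 3) κ)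
          = (C lam⁻¹ * C lam) * X 2 + C lam⁻¹ * ϑ + (-(C lam⁻¹ * C (t * bb⁻¹ ^ (r₁ / r₂)))) * η ^ (r₁ / r₂) := by ring
        _ = X 2 + (C lam⁻¹ * ϑ + C (-(lam⁻¹ * (t * bb⁻¹ ^ (r₁ / r₂)))) * η ^ (r₁ / r₂)) := by rw [h1, h2]; ring
  refine ⟨ε, τ, mul_ne_zero hē (inv_ne_zero hβ), ?_, ?_⟩
  · -- `τ` is free of `X₂`
    have hdegτ : τ.degreeOf 2 = 0 := by
      have h1 := degreeOf_add_le (2 : Fin 3) (C lam⁻¹ * ϑ) (C (-(lam⁻¹ * (t * bb⁻¹ ^ (r₁ / r₂)))) * η ^ (r₁ / r₂))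
      have h2 := degreeOf_mul_le (2 : Fin 3) (C lam⁻¹) ϑ
      have h3 := degreeOf_mul_le (2 : Fin 3) (C (-(lam⁻¹ * (t * bb⁻¹ ^ (r₁ / r₂))))) (η ^ (r₁ / r₂))
      have h4 := degreeOf_pow_le (2 : Fin 3) η (r₁ / r₂)
      rw [degreeOf_C] at h2 h3
      rw [hdegη, mul_zero] at h4
      rw [hdegϑ] at h2
      rw [hτ]
      omega
    intro e he
    have := degreeOf_le_iff.mp hdegτ.le e he
    omega
  · calc Φ = aeval ![X 0, η, ζ] Θ := hσΘ.symm
      _ = aeval ![X 0, η, ζ] (aeval ginv Φ) := by rw [← hΘeq]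
      _ = aeval (fun i => aeval ![X 0, η, ζ] (ginv i)) Φ := by rw [← AlgHom.comp_apply, comp_aeval]
      _ = aeval ![X 0, X 1 + C ε * X 0 ^ j, X 2 + τ] Φ := by rw [hcomp]

/-- **LEMMA C ⟸ LEMMA C′ (the functional-equation form).**  For fixed `κ`, `0 < r₂ < r₁`, `1 ≤ j`, `1 ≤ ν`: if every pure `Φ` containing
`X₂^ν` and fixed by a substitution `X₁ ↦ X₁ + εX₀^j`, `X₂ ↦ X₂ + τ` (`ε ≠ 0`, `τ` free of `X₂`) is `u (X₂ − a X₁^{r₁/r₂})^ν`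
(`a ≠ 0 ⇒ r₂ ∣ r₁`), then LEMMA C holds (hypothesis `hC` of `keyRungGrHomLE_three_of_lemmaC` at these parameters): the case `β̄ = 0` is
`lemmaC_of_coeff_X₁_eq_zero`, the case `β̄ ≠ 0` is `exists_functional_equation`. [OURS · L1 W4.3 · (o70-b)/(Δ12)] -/
theorem lemmaC_of_functional {r₁ r₂ j ν : ℕ} (hr₂ : 0 < r₂) (hr : r₂ < r₁) (hj : 1 ≤ j) (hν : 1 ≤ ν)
    (hC' : ∀ (Φ : MvPolynomial (Fin 3) κ) (ε : κ) (τ : MvPolynomial (Fin 3) κ),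
      (∀ e ∈ Φ.support, e 0 = 0 ∧ r₁ * e 2 + r₂ * e 1 = r₁ * ν) → Φ.coeff (Finsupp.single 2 ν) ≠ 0 → ε ≠ 0 →
      (∀ e ∈ τ.support, e 2 = 0) → Φ = aeval ![X 0, X 1 + C ε * X 0 ^ j, X 2 + τ] Φ →
      ∃ u a : κ, Φ = C u * (X 2 - C a * X 1 ^ (r₁ / r₂)) ^ ν ∧ (a ≠ 0 → r₂ ∣ r₁))
    (Φ η ζ : MvPolynomial (Fin 3) κ) (s : Finset (Fin 3 →₀ ℕ)) (θ : (Fin 3 →₀ ℕ) → κ)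
    (hΦ : ∀ e ∈ Φ.support, e 0 = 0 ∧ r₁ * e 2 + r₂ * e 1 = r₁ * ν) (hΦν : Φ.coeff (Finsupp.single 2 ν) ≠ 0)
    (hηhom : η.IsWeightedHomogeneous (![r₂, j * r₂, j * r₁] : Fin 3 → ℕ) (j * r₂))
    (hē : η.coeff (Finsupp.single 0 j) ≠ 0)
    (hζhom : ζ.IsWeightedHomogeneous (![r₂, j * r₂, j * r₁] : Fin 3 → ℕ) (j * r₁))
    (hs : ∀ e ∈ s, e 0 = 0 ∧ r₁ * e 2 + r₂ * e 1 = r₁ * ν) (hΦeq : Φ = ∑ e ∈ s, C (θ e) * (η ^ (e 1) * ζ ^ (e 2))) :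
    ∃ u a : κ, Φ = C u * (X 2 - C a * X 1 ^ (r₁ / r₂)) ^ ν ∧ (a ≠ 0 → r₂ ∣ r₁) := by
  by_cases hβ : η.coeff (Finsupp.single 1 1) = 0
  · exact lemmaC_of_coeff_X₁_eq_zero hr₂ hr hj hν hΦ hΦν hηhom hζhom hs hΦeq hβ
  · obtain ⟨ε, τ, hε, hτ, hfe⟩ := exists_functional_equation hr₂ hr hj hν hΦ hΦν hηhom hζhom hs hΦeq hē hβ
    exact hC' Φ ε τ hΦ hΦν hε hτ hfe

end LemmaC

end Iota3

end Summit.ResolutionOfSingularities.ResolutionOfSingularities.Cruxes.HypersurfaceCentreConstruction.LocalEngine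

end
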